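import Summits.Ventures.PackingBounds.Energy.TenPointCkFour
import Summits.Ventures.PackingBounds.Energy.GramCongrFaces
import Summits.Ventures.PackingBounds.Energy.ThreePointEnergyDeficit
import HarnessLib

/-!
# Ten points on `S³`, potential `(1+⟪x,y⟫)^4`: every minimiser is a `{0, (√5-1)/4, -(√5+1)/4}`-code (rigidity from the SOS face)

Framing: lottery ticket; floor = certified bounds/negative ranges. Venture `PackingBounds`, cell
`pub-packcert`, energy family E3PT (pub-packcert-energy gen 14; n = 4 kernel route = KERNEL-D6 data route + `threePointF 4`).

If ten unit vectors `C ⊂ ℝ⁴` attain `Σ_{x≠y} (1+⟪x,y⟫)^4 = 435/4`, the deficit identity (`ThreePointDeficit.energy_sub_bound_eq`)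
makes the slack of the three-point inequality vanish at every ordered triple of distinct points; the slack is `(1/K)·mᵀ X m`
(`slack_bridgeW4`), `X = P (S·Y) Pᵀ` with `S·Y ≻ 0` WITH MARGIN (`GramData.checkDDm`, kernel), so every face form `Σ_a P_{ai} m_a` vanishes
(`GramData.faces_vanish_of_congr`); the face-basis vector read off column 0 of the data (`GramData.checkCol`) is the univariate
`t³ + t²/2 - t/4 = t (t - (√5-1)/4) (t + (√5+1)/4)`, so every inner product of distinct points is `0`, `cos 72° = (√5-1)/4` or
`cos 144° = -(√5+1)/4` — the inner products of two orthogonal regular pentagons.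
-/

noncomputable section

open Finset
open scoped RealInnerProductSpace

namespace Summit.Ventures.PackingBounds.Energy.TenPointCkFour

open Literature.Geometry.DiscreteGeometry Literature.Geometry.DiscreteGeometry.BachocVallentin
open Literature.Analysis.SpecialFunctions Summit.Ventures.PackingBounds.Energy
open Summit.Ventures.PackingBounds.Energy.GramData Summit.Ventures.PackingBounds.Energy.PentagonsFourD6

set_option maxRecDepth 100000 in
/-- The remainder `E` of `S·Y = L Lᵀ + E` is diagonally dominant with margin `1` (kernel evaluation): `S·Y ≻ 0`. -/
theorem ddm_oneW4 : checkDDm 72 1 eW4 = true := by decide +kernel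

/-- Column 0 of the scaled face-basis matrix `bW4`: `64·(t³ + t²/2 - t/4)` on the monomials `t, t², t³`. -/
def faceColW4 : List ℤ := [0, -16, 32, 64, 0, 0, 0, 0, 0, 0, 0, 0, 0, 0, 0, 0, 0, 0, 0, 0, 0, 0, 0, 0, 0, 0, 0, 0, 0, 0, 0, 0, 0, 0, 0, 0, 0, 0, 0, 0, 0, 0, 0, 0, 0, 0, 0, 0, 0, 0, 0, 0, 0, 0, 0, 0, 0, 0, 0, 0, 0, 0, 0, 0, 0, 0, 0, 0, 0, 0, 0, 0, 0, 0, 0, 0, 0, 0, 0, 0, 0, 0, 0, 0]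

set_option maxRecDepth 100000 in
/-- `faceColW4` is column 0 of `bW4` (kernel evaluation). -/
theorem faceCol_okW4 : checkCol 84 bW4 0 faceColW4 = true := by decide +kernel

set_option maxRecDepth 100000 in
set_option maxHeartbeats 4000000 in
/-- If the monomial-side form `mᵀ X m` vanishes at `(u,v,t)`, then `t ∈ {0, (√5-1)/4, -(√5+1)/4}`. -/
theorem t_of_listQuad_eq_zeroW4 (u v t : ℝ) (h0 : listQuad (mvecW4 u v t) xW4 0 = 0) :
    t = 0 ∨ t = (-1 + Real.sqrt 5) / 4 ∨ t = (-1 - Real.sqrt 5) / 4 := by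
  have hXlen : xW4.length = 84 := by decide
  have hXrow : ∀ m, m < 84 → (xW4.getD m []).length = 84 := by decide +kernel
  have hB : ∀ a, a < 84 → (bW4.getD a []).length = 72 := by decide +kernel
  have hv := faces_vanish_of_congr 84 72 72 1 le_rfl bW4 yW4 xW4 lW4 eW4 hXlen hXrow hB congrW4_all rowsW4_all
    (of_checkDDm ddm_oneW4) (mvecW4 u v t) h0 ⟨0, by norm_num⟩
  have hv' : ∑ a : Fin 84, (ent bW4 a 0 : ℝ) * mvecW4 u v t a = 0 := hv
  rw [sum_ent_eq_linForm faceCol_okW4 (by decide) (mvecW4 u v t)] at hv'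
  simp only [linForm, faceColW4, mvecW4, Nat.reduceAdd, Int.cast_zero, zero_mul, zero_add, add_zero] at hv'
  push_cast at hv'
  have hX : Real.sqrt 5 ^ 2 = 5 := Real.sq_sqrt (by norm_num)
  have hf : t * ((t - (-1 + Real.sqrt 5) / 4) * (t - (-1 - Real.sqrt 5) / 4)) = 0 := by
    linear_combination (1 / 64 : ℝ) * hv' - (t / 16) * hX
  rcases mul_eq_zero.1 hf with h | h
  · exact Or.inl h
  · rcases mul_eq_zero.1 h with h | h
    · exact Or.inr (Or.inl (by linarith))
    · exact Or.inr (Or.inr (by linarith))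

/-- **Rigidity of the `(1+t)^4`-energy ground state of ten points on `S³`.** If ten unit vectors of `ℝ⁴` attain
`Σ_{x≠y} (1+⟪x,y⟫)^4 = 435/4`, then every inner product of two distinct points is `0`, `(√5-1)/4` or `-(√5+1)/4`. -/
theorem ck4_ten_points_rigid (C : Finset (EuclideanSpace ℝ (Fin 4))) (hC : ∀ x ∈ C, ‖x‖ = 1)
    (h10 : C.card = 10)
    (hmin : ∑ x ∈ C, ∑ y ∈ C.erase x, (1 + inner ℝ x y) ^ 4 = ((435 : ℝ)/4)) :
    ∀ x ∈ C, ∀ y ∈ C, x ≠ y → inner ℝ x y = 0 ∨ inner ℝ x y = (-1 + Real.sqrt 5) / 4 ∨ inner ℝ x y = (-1 - Real.sqrt 5) / 4 := by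
  classical
  have hA := pairSum_gegenbauer_comb_nonneg (n := 4) (by norm_num) 6 acoKW4 aco_nonnegW4 C hC
  have hF := tripleSum_threePointF_nonneg (n := 4) le_rfl 7 6 dcoKW4 dco_nonnegW4 gwKW4 C hC
  have hcard : (C.card : ℝ) = 10 := by exact_mod_cast h10
  have hAeval : ∀ w : ℝ, (∑ k ∈ range (6 + 1), acoKW4 k * gegenbauerSum ((((4 : ℕ) : ℝ) - 2) / 2) k w) = aPolyKW4 w := by
    intro w
    have hμ : ((((4 : ℕ) : ℝ) - 2) / 2) = (1 : ℝ) := by norm_num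
    rw [hμ]
    have h0 : acoKW4 0 = 0 := rfl
    have h1 : acoKW4 1 = (((399592627704909584981803 : ℝ)/2966193212496073143091200)) / 2 := rfl
    have h2 : acoKW4 2 = (((1752310931943086940223 : ℝ)/87887206296179944980480)) / 3 := rfl
    have h3 : acoKW4 3 = (((536261332172047320281 : ℝ)/13732375983778116403200)) / 4 := rfl
    have h4 : acoKW4 4 = 0 := rfl
    have h5 : acoKW4 5 = 0 := rfl
    have h6 : acoKW4 6 = (((1628079691718364185 : ℝ)/470824319443821133824)) / 7 := rfl
    simp only [Finset.sum_range_succ, Finset.sum_range_zero, h0, h1, h2, h3, h4, h5, h6, ChebyshevU.c1_0, ChebyshevU.c1_1, ChebyshevU.c1_2, ChebyshevU.c1_3, ChebyshevU.c1_4, ChebyshevU.c1_5, ChebyshevU.c1_6, aPolyKW4]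
    ring
  have hineq : ∀ u v t : ℝ, -1 ≤ u → u < 1 → -1 ≤ v → v < 1 → -1 ≤ t → t < 1 →
      0 ≤ 1 + 2 * u * v * t - u ^ 2 - v ^ 2 - t ^ 2 →
      c0KW4 + ((C.card : ℝ) - 2) * threePointF 4 7 6 dcoKW4 gwKW4 u v t + threePointF 4 7 6 dcoKW4 gwKW4 u u 1
        + threePointF 4 7 6 dcoKW4 gwKW4 v v 1 + threePointF 4 7 6 dcoKW4 gwKW4 t t 1
        + ((fun w => ∑ k ∈ range (6 + 1), acoKW4 k * gegenbauerSum ((((4 : ℕ) : ℝ) - 2) / 2) k w) u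
          + (fun w => ∑ k ∈ range (6 + 1), acoKW4 k * gegenbauerSum ((((4 : ℕ) : ℝ) - 2) / 2) k w) v
          + (fun w => ∑ k ∈ range (6 + 1), acoKW4 k * gegenbauerSum ((((4 : ℕ) : ℝ) - 2) / 2) k w) t) / 3
        ≤ (pminKW4 u + pminKW4 v + pminKW4 t) / 3 := by
    intro u v t hu1 hu2 hv1 hv2 ht1 ht2 hdet
    simp only [hAeval, hcard, threePointF_eqW4]
    have h1 := slack_nonnegW4 u v t
    linarith
  have hEp : ∑ x ∈ C, ∑ y ∈ C.erase x, pminKW4 (inner ℝ x y) = ((435 : ℝ)/4) := by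
    rw [← hmin]
    refine Finset.sum_congr rfl fun x _ => Finset.sum_congr rfl fun y _ => ?_
    simp only [pminKW4]; ring
  have hsharp : ∑ x ∈ C, ∑ y ∈ C.erase x, pminKW4 (inner ℝ x y)
      = (C.card : ℝ) * (((C.card : ℝ) - 1) * c0KW4 - threePointF 4 7 6 dcoKW4 gwKW4 1 1 1 - (fun w => ∑ k ∈ range (6 + 1), acoKW4 k * gegenbauerSum ((((4 : ℕ) : ℝ) - 2) / 2) k w) 1) := by
    simp only [hAeval, hcard, threePointF_eqW4]
    rw [hEp, ← bound_eqW4]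
  obtain ⟨hA0, hF0⟩ := ThreePointDeficit.pairSum_eq_zero_of_sharp C hC (by omega) pminKW4 _ _ c0KW4 hA hF
    (threePointF_swap12 4 7 6 dcoKW4 gwKW4) (threePointF_swap23 4 7 6 dcoKW4 gwKW4) hineq hsharp
  have hid := ThreePointDeficit.energy_sub_bound_eq C hC (by omega) pminKW4 (fun w => ∑ k ∈ range (6 + 1), acoKW4 k * gegenbauerSum ((((4 : ℕ) : ℝ) - 2) / 2) k w)
    (threePointF 4 7 6 dcoKW4 gwKW4) c0KW4
    (threePointF_swap12 4 7 6 dcoKW4 gwKW4) (threePointF_swap23 4 7 6 dcoKW4 gwKW4)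
  rw [hsharp, sub_self, hA0, hF0, add_zero, add_zero] at hid
  have hrange : ∀ x ∈ C, ∀ y ∈ C, x ≠ y → -1 ≤ inner ℝ x y ∧ inner ℝ x y < 1 := by
    intro x hx y hy hxy
    refine ⟨neg_one_le_real_inner_of_norm_eq_one (hC x hx) (hC y hy),
      lt_of_le_of_ne (real_inner_le_one_of_norm_eq_one (hC x hx) (hC y hy)) ?_⟩
    intro h1
    exact hxy ((inner_eq_one_iff_of_norm_eq_one (𝕜 := ℝ) (hC x hx) (hC y hy)).1 h1)
  set T : EuclideanSpace ℝ (Fin 4) → EuclideanSpace ℝ (Fin 4) → EuclideanSpace ℝ (Fin 4) → ℝ :=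
    fun x y z => ((pminKW4 (inner ℝ x y) + pminKW4 (inner ℝ x z) + pminKW4 (inner ℝ y z))
        - (3 * c0KW4 + 3 * (((C.card : ℝ) - 2) * threePointF 4 7 6 dcoKW4 gwKW4 (inner ℝ x y) (inner ℝ x z) (inner ℝ y z))
          + 3 * (threePointF 4 7 6 dcoKW4 gwKW4 (inner ℝ x y) (inner ℝ x y) 1
            + threePointF 4 7 6 dcoKW4 gwKW4 (inner ℝ x z) (inner ℝ x z) 1
            + threePointF 4 7 6 dcoKW4 gwKW4 (inner ℝ y z) (inner ℝ y z) 1)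
          + ((fun w => ∑ k ∈ range (6 + 1), acoKW4 k * gegenbauerSum ((((4 : ℕ) : ℝ) - 2) / 2) k w) (inner ℝ x y)
            + (fun w => ∑ k ∈ range (6 + 1), acoKW4 k * gegenbauerSum ((((4 : ℕ) : ℝ) - 2) / 2) k w) (inner ℝ x z)
            + (fun w => ∑ k ∈ range (6 + 1), acoKW4 k * gegenbauerSum ((((4 : ℕ) : ℝ) - 2) / 2) k w) (inner ℝ y z))))
    with hTdef
  have hTnn : ∀ x ∈ C, ∀ y ∈ C.erase x, ∀ z ∈ (C.erase x).erase y, 0 ≤ T x y z := by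
    intro x hx y hy z hz
    have hyC : y ∈ C := Finset.mem_of_mem_erase hy
    have hxy : x ≠ y := fun h => (Finset.ne_of_mem_erase hy) h.symm
    have hz1 : z ∈ C.erase x := Finset.mem_of_mem_erase hz
    have hzC : z ∈ C := Finset.mem_of_mem_erase hz1
    have hzy : z ≠ y := Finset.ne_of_mem_erase hz
    have hzx : z ≠ x := Finset.ne_of_mem_erase hz1
    obtain ⟨lo1, hi1⟩ := hrange x hx y hyC hxy
    obtain ⟨lo2, hi2⟩ := hrange x hx z hzC hzx.symm
    obtain ⟨lo3, hi3⟩ := hrange y hyC z hzC hzy.symm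
    have h0 := hineq _ _ _ lo1 hi1 lo2 hi2 lo3 hi3
      (BachocVallentin.gram3_nonneg x y z (hC x hx) (hC y hyC) (hC z hzC))
    simp only [hTdef]
    linarith
  have hSum0 : ∑ x ∈ C, ∑ y ∈ C.erase x, ∑ z ∈ (C.erase x).erase y, T x y z = 0 := by
    have hpos : (0 : ℝ) < 1 / (3 * ((C.card : ℝ) - 2)) := by rw [hcard]; norm_num
    have h := hid.symm
    simp only [hTdef]
    rcases mul_eq_zero.1 h with h1 | h1
    · exact absurd h1 hpos.ne'
    · exact h1
  have hT0 : ∀ x ∈ C, ∀ y ∈ C.erase x, ∀ z ∈ (C.erase x).erase y, T x y z = 0 := by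
    have h1 := (Finset.sum_eq_zero_iff_of_nonneg (fun x hx =>
      Finset.sum_nonneg fun y hy => Finset.sum_nonneg fun z hz => hTnn x hx y hy z hz)).1 hSum0
    intro x hx
    have h2 := (Finset.sum_eq_zero_iff_of_nonneg (fun y hy =>
      Finset.sum_nonneg fun z hz => hTnn x hx y hy z hz)).1 (h1 x hx)
    intro y hy
    exact (Finset.sum_eq_zero_iff_of_nonneg (fun z hz => hTnn x hx y hy z hz)).1 (h2 y hy)
  intro y hy z hz hyz
  have hcard3 : 0 < ((C.erase y).erase z).card := by
    rw [Finset.card_erase_of_mem (Finset.mem_erase.2 ⟨fun h => hyz h.symm, hz⟩),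
      Finset.card_erase_of_mem hy, h10]; norm_num
  obtain ⟨x, hx⟩ := Finset.card_pos.1 hcard3
  have hx1 : x ∈ C.erase y := Finset.mem_of_mem_erase hx
  have hxC : x ∈ C := Finset.mem_of_mem_erase hx1
  have hxz : x ≠ z := Finset.ne_of_mem_erase hx
  have hxy : x ≠ y := Finset.ne_of_mem_erase hx1
  have hy' : y ∈ C.erase x := Finset.mem_erase.2 ⟨fun h => hxy h.symm, hy⟩
  have hz' : z ∈ (C.erase x).erase y := Finset.mem_erase.2 ⟨fun h => hyz h.symm, Finset.mem_erase.2 ⟨fun h => hxz h.symm, hz⟩⟩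
  have hT := hT0 x hxC y hy' z hz'
  simp only [hTdef, hAeval, hcard, threePointF_eqW4] at hT
  set u := inner ℝ x y with hu
  set v := inner ℝ x z with hv
  set t := inner ℝ y z with ht
  have hs : (pminKW4 u + pminKW4 v + pminKW4 t) / 3 - (c0KW4 + 8 * FexpKW4 u v t + FexpKW4 u u 1 + FexpKW4 v v 1 + FexpKW4 t t 1
      + (aPolyKW4 u + aPolyKW4 v + aPolyKW4 t) / 3) = 0 := by
    linarith [hT]
  have hb := slack_bridgeW4 u v t
  rw [hs, mul_zero] at hb
  exact t_of_listQuad_eq_zeroW4 u v t hb.symm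

/-- **Balance of the `(1+t)^4`-energy ground state of ten points on `S³`.** If ten unit vectors of `ℝ⁴` attain
`Σ_{x≠y} (1+⟪x,y⟫)^4 = 435/4`, then `Σ x = 0` (complementary slackness of the two-point part: `a₁ > 0`). -/
theorem ck4_ten_points_balanced (C : Finset (EuclideanSpace ℝ (Fin 4))) (hC : ∀ x ∈ C, ‖x‖ = 1)
    (h10 : C.card = 10)
    (hmin : ∑ x ∈ C, ∑ y ∈ C.erase x, (1 + inner ℝ x y) ^ 4 = ((435 : ℝ)/4)) :
    ∑ x ∈ C, x = 0 := by
  classical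
  have hA := pairSum_gegenbauer_comb_nonneg (n := 4) (by norm_num) 6 acoKW4 aco_nonnegW4 C hC
  have hF := tripleSum_threePointF_nonneg (n := 4) le_rfl 7 6 dcoKW4 dco_nonnegW4 gwKW4 C hC
  have hcard : (C.card : ℝ) = 10 := by exact_mod_cast h10
  have hAeval : ∀ w : ℝ, (∑ k ∈ range (6 + 1), acoKW4 k * gegenbauerSum ((((4 : ℕ) : ℝ) - 2) / 2) k w) = aPolyKW4 w := by
    intro w
    have hμ : ((((4 : ℕ) : ℝ) - 2) / 2) = (1 : ℝ) := by norm_num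
    rw [hμ]
    have h0 : acoKW4 0 = 0 := rfl
    have h1 : acoKW4 1 = (((399592627704909584981803 : ℝ)/2966193212496073143091200)) / 2 := rfl
    have h2 : acoKW4 2 = (((1752310931943086940223 : ℝ)/87887206296179944980480)) / 3 := rfl
    have h3 : acoKW4 3 = (((536261332172047320281 : ℝ)/13732375983778116403200)) / 4 := rfl
    have h4 : acoKW4 4 = 0 := rfl
    have h5 : acoKW4 5 = 0 := rfl
    have h6 : acoKW4 6 = (((1628079691718364185 : ℝ)/470824319443821133824)) / 7 := rfl
    simp only [Finset.sum_range_succ, Finset.sum_range_zero, h0, h1, h2, h3, h4, h5, h6, ChebyshevU.c1_0, ChebyshevU.c1_1, ChebyshevU.c1_2, ChebyshevU.c1_3, ChebyshevU.c1_4, ChebyshevU.c1_5, ChebyshevU.c1_6, aPolyKW4]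
    ring
  have hineq : ∀ u v t : ℝ, -1 ≤ u → u < 1 → -1 ≤ v → v < 1 → -1 ≤ t → t < 1 →
      0 ≤ 1 + 2 * u * v * t - u ^ 2 - v ^ 2 - t ^ 2 →
      c0KW4 + ((C.card : ℝ) - 2) * threePointF 4 7 6 dcoKW4 gwKW4 u v t + threePointF 4 7 6 dcoKW4 gwKW4 u u 1
        + threePointF 4 7 6 dcoKW4 gwKW4 v v 1 + threePointF 4 7 6 dcoKW4 gwKW4 t t 1
        + ((fun w => ∑ k ∈ range (6 + 1), acoKW4 k * gegenbauerSum ((((4 : ℕ) : ℝ) - 2) / 2) k w) u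
          + (fun w => ∑ k ∈ range (6 + 1), acoKW4 k * gegenbauerSum ((((4 : ℕ) : ℝ) - 2) / 2) k w) v
          + (fun w => ∑ k ∈ range (6 + 1), acoKW4 k * gegenbauerSum ((((4 : ℕ) : ℝ) - 2) / 2) k w) t) / 3
        ≤ (pminKW4 u + pminKW4 v + pminKW4 t) / 3 := by
    intro u v t hu1 hu2 hv1 hv2 ht1 ht2 hdet
    simp only [hAeval, hcard, threePointF_eqW4]
    have h1 := slack_nonnegW4 u v t
    linarith
  have hEp : ∑ x ∈ C, ∑ y ∈ C.erase x, pminKW4 (inner ℝ x y) = ((435 : ℝ)/4) := by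
    rw [← hmin]
    refine Finset.sum_congr rfl fun x _ => Finset.sum_congr rfl fun y _ => ?_
    simp only [pminKW4]; ring
  have hsharp : ∑ x ∈ C, ∑ y ∈ C.erase x, pminKW4 (inner ℝ x y)
      = (C.card : ℝ) * (((C.card : ℝ) - 1) * c0KW4 - threePointF 4 7 6 dcoKW4 gwKW4 1 1 1 - (fun w => ∑ k ∈ range (6 + 1), acoKW4 k * gegenbauerSum ((((4 : ℕ) : ℝ) - 2) / 2) k w) 1) := by
    simp only [hAeval, hcard, threePointF_eqW4]
    rw [hEp, ← bound_eqW4]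
  obtain ⟨hA0, -⟩ := ThreePointDeficit.pairSum_eq_zero_of_sharp C hC (by omega) pminKW4 _ _ c0KW4 hA hF
    (threePointF_swap12 4 7 6 dcoKW4 gwKW4) (threePointF_swap23 4 7 6 dcoKW4 gwKW4) hineq hsharp
  have hswap : BachocVallentin.pairSum C (fun w => ∑ k ∈ range (6 + 1), acoKW4 k * gegenbauerSum ((((4 : ℕ) : ℝ) - 2) / 2) k w)
      = ∑ k ∈ range (6 + 1), acoKW4 k * BachocVallentin.pairSum C (fun t => gegenbauerSum ((((4 : ℕ) : ℝ) - 2) / 2) k t) := by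
    simp only [BachocVallentin.pairSum, Finset.mul_sum]
    have h1 : ∀ x ∈ C, (∑ y ∈ C, ∑ k ∈ range (6 + 1),
        acoKW4 k * gegenbauerSum ((((4 : ℕ) : ℝ) - 2) / 2) k (inner ℝ x y)) =
        ∑ k ∈ range (6 + 1), ∑ y ∈ C, acoKW4 k * gegenbauerSum ((((4 : ℕ) : ℝ) - 2) / 2) k (inner ℝ x y) :=
      fun x _ => Finset.sum_comm
    rw [Finset.sum_congr rfl h1, Finset.sum_comm]
  rw [hswap] at hA0
  have hterm : ∀ k ∈ range (6 + 1), 0 ≤ acoKW4 k * BachocVallentin.pairSum C (fun t => gegenbauerSum ((((4 : ℕ) : ℝ) - 2) / 2) k t) :=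
    fun k _ => mul_nonneg (aco_nonnegW4 k) (pairSum_gegenbauer_nonneg (n := 4) (by norm_num) k C hC)
  have h1 := (Finset.sum_eq_zero_iff_of_nonneg hterm).1 hA0 1 (by simp)
  have ha1 : (0 : ℝ) < acoKW4 1 := by
    have h : acoKW4 1 = (((399592627704909584981803 : ℝ)/2966193212496073143091200)) / 2 := rfl
    rw [h]; norm_num
  have hP1 : BachocVallentin.pairSum C (fun t => gegenbauerSum ((((4 : ℕ) : ℝ) - 2) / 2) 1 t) = 0 := by
    rcases mul_eq_zero.1 h1 with h | h
    · exact absurd h ha1.ne'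
    · exact h
  have hfun : (fun t => gegenbauerSum ((((4 : ℕ) : ℝ) - 2) / 2) 1 t) = fun t => (2 : ℝ) * t := by
    funext t; rw [gegenbauerSum_one]; push_cast; ring
  rw [hfun] at hP1
  exact ThreePointDeficit.sum_eq_zero_of_sharp C 2 (by norm_num) hP1

end Summit.Ventures.PackingBounds.Energy.TenPointCkFour
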